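import Mathlib
import Summits.NavierStokesRegularity.NavierStokesRegularity.Theorems.FilamentSkeletonRssStadiumPairPositivity

/-!
# Route `FilamentSkeletonRss` · child crux `TangentSkeletonNearStraightL` (stmt-NavierStokesRegularity-23320) · registered line
# `child_tangent_analytic_strip_L` (b0b56c52900dd90a), stub `stub_stripPropagation` — brick: THE FOOT ESTIMATE WITH THE QUADRIC ORTHOGONALITY

For a target `z = x₁ + iY` and a source `ζ = x₂ + iη` that are not close, `Re Σᵢ (Fᵢ(z) − Fᵢ(ζ))² > 0` is obtained by descending to the
real feet: `Re v = X(x₁) − X(x₂) + smears`, `Im v = Y·X′(x₁) − η·X′(x₂) + smears`, `Re Σ vᵢ² = ‖Re v‖² − ‖Im v‖²`.  The landed versions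
(`Theorems.StadiumVerticalDisplacement`, `Theorems.StadiumVerticalLinear(Abs)`) pay the horizontal smear `∫₀^Y ‖Im F′‖` in FULL (`≈ 0.13·hs`
per foot at disc ratio 3) and die in the window `|x₂ − x₁| ∈ [0.38, 0.48]·hs` of the registered quarter-width corner that no chord estimate
reaches.  Here only the component ALONG THE TANGENT is paid, and it is SECOND order: `Σ (F′)ᵢ² = 1` makes `Re F′ ⊥ Im F′`
(`Theorems.StadiumPairPositivity.sum_re_mul_im`), so `|⟨Im F′(w), T⟩| ≤ ‖Im F′(w)‖·‖Re F′(w) − T‖` (`abs_sum_im_mul_le`).  Consequences with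
continuous pointwise profiles along the vertical legs: `abs_re_proj_vertical_sub_le` (`|⟨Re F(x+it) − Re F(x), T′⟩| ≤ ∫₀ᵗ q(e + ρ)`),
`euclid_im_vertical_sub_linear_le` (`‖Im F(x+it) − t·T‖ ≤ ∫₀ᵗ e`, by duality), and THE FOOT ESTIMATE `re_chord_sq_ge_of_feet`:
`(c₀ − J₁ − J₂)² − (√((Y−η)² + Yηρ²) + I₁ + I₂)² ≤ Re Σᵢ (Fᵢ(x₁+iY) − Fᵢ(x₂+iη))²`, `J₁ = ∫₀^Y q₁e₁`, `J₂ = ∫₀^η q₂(e₂+ρ)`, `I₁ = ∫₀^Y e₁`,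
`I₂ = ∫₀^η e₂`.  Census number (landed-style Cauchy profiles, `Rb = 1/2`): the right-hand descent at the registered output corner is certified
with worst relative margin `+0.116` (full-smear version: `−0.13`).
HONEST FRAMING: elementary bricks for a plan about a HYPOTHETICAL filament skeleton on the NEGATIVE side of a MODEL route; the stub
`stub_stripPropagation` is NOT closed by this file; nothing here bears on Navier–Stokes regularity or blow-up.  `--supports stmt-NavierStokesRegularity-23320`.
-/

set_option linter.dupNamespace false

noncomputable section

namespace Summit.NavierStokesRegularity.NavierStokesRegularity.Theorems.StadiumFootTangential

open Set MeasureTheory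
open scoped BigOperators
open Summit.NavierStokesRegularity.NavierStokesRegularity.Theorems.StadiumPairPositivity

/-- **Tangential imaginary part.**  For `c : ℂ³` on the quadric `Σ cᵢ² = 1` and any real `T`:
`|Σ (Im cᵢ)·Tᵢ| ≤ ‖Im c‖·‖Re c − T‖` (Euclidean) — because `Re c ⊥ Im c`. [folklore] -/
theorem abs_sum_im_mul_le (c : Fin 3 → ℂ) (hc : ∑ i, c i ^ 2 = 1) (T : Fin 3 → ℝ) :
    |∑ i, (c i).im * T i| ≤ √(∑ i, (c i).im ^ 2) * √(∑ i, ((c i).re - T i) ^ 2) := by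
  have h0 := sum_re_mul_im c hc
  have h1 : ∑ i, (c i).im * T i = -(∑ i, (c i).im * ((c i).re - T i)) := by
    have h2 : ∑ i, (c i).im * ((c i).re - T i) = ∑ i, (c i).re * (c i).im - ∑ i, (c i).im * T i := by
      rw [← Finset.sum_sub_distrib]
      exact Finset.sum_congr rfl fun i _ => by ring
    rw [h2, h0]; ring
  rw [h1, abs_neg]
  exact abs_sum_mul_le_sqrt_mul_sqrt _ _

/-- `abs_sum_im_mul_le` with radii: `‖Im c‖ ≤ q`, `‖Re c − T‖ ≤ e` ⇒ `|Σ (Im cᵢ)Tᵢ| ≤ q·e`. [folklore] -/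
theorem abs_sum_im_mul_le_of_le (c : Fin 3 → ℂ) (hc : ∑ i, c i ^ 2 = 1) (T : Fin 3 → ℝ) {q e : ℝ}
    (hq : √(∑ i, (c i).im ^ 2) ≤ q) (he : √(∑ i, ((c i).re - T i) ^ 2) ≤ e) :
    |∑ i, (c i).im * T i| ≤ q * e :=
  (abs_sum_im_mul_le c hc T).trans
    (mul_le_mul hq he (Real.sqrt_nonneg _) ((Real.sqrt_nonneg _).trans hq))

/-- Tangential imaginary part against a NEARBY unit vector `T′` (`‖T − T′‖ ≤ ρ`): `|Σ (Im cᵢ)T′ᵢ| ≤ q·(e + ρ)`. [folklore] -/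
theorem abs_sum_im_mul_le_of_le' (c : Fin 3 → ℂ) (hc : ∑ i, c i ^ 2 = 1) (T T' : Fin 3 → ℝ) {q e ρ : ℝ}
    (hq : √(∑ i, (c i).im ^ 2) ≤ q) (he : √(∑ i, ((c i).re - T i) ^ 2) ≤ e)
    (hρ : √(∑ i, (T i - T' i) ^ 2) ≤ ρ) :
    |∑ i, (c i).im * T' i| ≤ q * (e + ρ) := by
  have h1 : ∑ i, (c i).im * T' i = ∑ i, (c i).im * T i - ∑ i, (c i).im * (T i - T' i) := by
    rw [← Finset.sum_sub_distrib]
    exact Finset.sum_congr rfl fun i _ => by ring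
  have h2 := abs_sum_im_mul_le_of_le c hc T hq he
  have h3 : |∑ i, (c i).im * (T i - T' i)| ≤ q * ρ :=
    (abs_sum_mul_le_sqrt_mul_sqrt _ _).trans
      (mul_le_mul hq hρ (Real.sqrt_nonneg _) ((Real.sqrt_nonneg _).trans hq))
  rw [h1]
  calc |∑ i, (c i).im * T i - ∑ i, (c i).im * (T i - T' i)|
      ≤ |∑ i, (c i).im * T i| + |∑ i, (c i).im * (T i - T' i)| := abs_sub _ _
    _ ≤ q * e + q * ρ := add_le_add h2 h3
    _ = q * (e + ρ) := by ring

/-- **Euclidean norm by duality.**  If `Σ wᵢℓᵢ ≤ b` for every real unit `ℓ`, then `√(Σ wᵢ²) ≤ b`. [folklore] -/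
theorem euclid_norm_le_of_forall_dot_le (w : Fin 3 → ℝ) {b : ℝ}
    (h : ∀ ℓ : Fin 3 → ℝ, ∑ i, ℓ i ^ 2 = 1 → ∑ i, w i * ℓ i ≤ b) : √(∑ i, w i ^ 2) ≤ b := by
  by_cases hw : ∑ i, w i ^ 2 = 0
  · rw [hw, Real.sqrt_zero]
    have h1 := h (fun i => if i = 0 then 1 else 0) (by simp)
    simp only [Fin.sum_univ_three, Fin.isValue, ↓reduceIte, mul_one, one_ne_zero, mul_zero, add_zero,
      Fin.reduceEq] at h1
    have h2 : ∀ i, w i = 0 := by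
      intro i
      have hle : w i ^ 2 ≤ ∑ j, w j ^ 2 := Finset.single_le_sum (fun j _ => sq_nonneg (w j)) (Finset.mem_univ i)
      rw [hw] at hle
      exact pow_eq_zero_iff (n := 2) (by norm_num) |>.1 (le_antisymm hle (sq_nonneg _))
    rw [h2 0] at h1
    exact h1
  · have hpos : 0 < ∑ i, w i ^ 2 := lt_of_le_of_ne (Finset.sum_nonneg fun i _ => sq_nonneg _) (Ne.symm hw)
    set N : ℝ := √(∑ i, w i ^ 2) with hN
    have hNpos : 0 < N := Real.sqrt_pos.2 hpos
    have hN2 : N ^ 2 = ∑ i, w i ^ 2 := Real.sq_sqrt hpos.le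
    have h1 := h (fun i => w i / N) (by
      have : ∑ i, (w i / N) ^ 2 = (∑ i, w i ^ 2) / N ^ 2 := by
        rw [Finset.sum_div]; exact Finset.sum_congr rfl fun i _ => by rw [div_pow]
      rw [this, hN2, div_self (ne_of_gt hpos)])
    have h2 : ∑ i, w i * (w i / N) = N := by
      have : ∑ i, w i * (w i / N) = (∑ i, w i ^ 2) / N := by
        rw [Finset.sum_div]; exact Finset.sum_congr rfl fun i _ => by rw [sq]; ring
      rw [this, ← hN2, sq, mul_div_assoc, div_self (ne_of_gt hNpos), mul_one]
    rw [h2] at h1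
    exact h1

/-- Derivative of the vertical lift `u ↦ F(x + iu)`. [folklore] -/
theorem hasDerivAt_vertical_lift {U : Set ℂ} (hU : IsOpen U) {F : ℂ → (Fin 3 → ℂ)} (hF : DifferentiableOn ℂ F U)
    {x u : ℝ} (hmem : (x : ℂ) + (u : ℂ) * Complex.I ∈ U) :
    HasDerivAt (fun u : ℝ => F ((x : ℂ) + (u : ℂ) * Complex.I))
      (Complex.I • deriv F ((x : ℂ) + (u : ℂ) * Complex.I)) u := by
  have hFd : HasDerivAt F (deriv F ((x : ℂ) + (u : ℂ) * Complex.I)) ((x : ℂ) + (u : ℂ) * Complex.I) :=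
    (hF.differentiableAt (hU.mem_nhds hmem)).hasDerivAt
  have hp : HasDerivAt (fun u : ℝ => (x : ℂ) + (u : ℂ) * Complex.I) Complex.I u := by
    have h1 := (((hasDerivAt_id u).ofReal_comp).mul_const Complex.I).const_add (x : ℂ)
    simpa using h1
  exact hFd.scomp u hp

/-- Derivative of the projected real part along the vertical leg: `d/du Σᵢ Re Fᵢ(x+iu)·T′ᵢ = −Σᵢ Im F′ᵢ(x+iu)·T′ᵢ`. [folklore] -/
theorem hasDerivAt_re_proj_vertical {U : Set ℂ} (hU : IsOpen U) {F : ℂ → (Fin 3 → ℂ)} (hF : DifferentiableOn ℂ F U)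
    {x u : ℝ} (hmem : (x : ℂ) + (u : ℂ) * Complex.I ∈ U) (T' : Fin 3 → ℝ) :
    HasDerivAt (fun u : ℝ => ∑ i, (F ((x : ℂ) + (u : ℂ) * Complex.I) i).re * T' i)
      (-(∑ i, (deriv F ((x : ℂ) + (u : ℂ) * Complex.I) i).im * T' i)) u := by
  have hG := hasDerivAt_vertical_lift hU hF hmem
  have hcomp : ∀ i, HasDerivAt (fun u : ℝ => (F ((x : ℂ) + (u : ℂ) * Complex.I) i).re * T' i)
      (-((deriv F ((x : ℂ) + (u : ℂ) * Complex.I) i).im) * T' i) u := by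
    intro i
    have h1 : HasDerivAt (fun u : ℝ => F ((x : ℂ) + (u : ℂ) * Complex.I) i)
        (Complex.I * deriv F ((x : ℂ) + (u : ℂ) * Complex.I) i) u := by
      have h := (hasDerivAt_pi.1 hG) i
      simpa [Pi.smul_apply, smul_eq_mul] using h
    have h2 := Complex.reCLM.hasFDerivAt.comp_hasDerivAt u h1
    have h3 : HasDerivAt (fun u : ℝ => (F ((x : ℂ) + (u : ℂ) * Complex.I) i).re)
        (-((deriv F ((x : ℂ) + (u : ℂ) * Complex.I) i).im)) u := by
      have e : Complex.reCLM (Complex.I * deriv F ((x : ℂ) + (u : ℂ) * Complex.I) i) =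
          -((deriv F ((x : ℂ) + (u : ℂ) * Complex.I) i).im) := by
        rw [Complex.reCLM_apply, Complex.I_mul_re]
      rw [e] at h2
      exact h2
    exact h3.mul_const (T' i)
  have hsum := HasDerivAt.fun_sum (u := Finset.univ) fun i _ => hcomp i
  have e : ∑ i ∈ Finset.univ, -((deriv F ((x : ℂ) + (u : ℂ) * Complex.I) i).im) * T' i =
      -(∑ i, (deriv F ((x : ℂ) + (u : ℂ) * Complex.I) i).im * T' i) := by
    rw [← Finset.sum_neg_distrib]
    exact Finset.sum_congr rfl fun i _ => by ring
  rw [e] at hsum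
  exact hsum

/-- Derivative of the projected imaginary part minus its linear part along the vertical leg:
`d/du (Σᵢ Im Fᵢ(x+iu)·ℓᵢ − u·Σᵢ Tᵢℓᵢ) = Σᵢ (Re F′ᵢ(x+iu) − Tᵢ)·ℓᵢ`. [folklore] -/
theorem hasDerivAt_im_proj_vertical {U : Set ℂ} (hU : IsOpen U) {F : ℂ → (Fin 3 → ℂ)} (hF : DifferentiableOn ℂ F U)
    {x u : ℝ} (hmem : (x : ℂ) + (u : ℂ) * Complex.I ∈ U) (T ℓ : Fin 3 → ℝ) :
    HasDerivAt (fun u : ℝ => ∑ i, (F ((x : ℂ) + (u : ℂ) * Complex.I) i).im * ℓ i - u * ∑ i, T i * ℓ i)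
      (∑ i, ((deriv F ((x : ℂ) + (u : ℂ) * Complex.I) i).re - T i) * ℓ i) u := by
  have hG := hasDerivAt_vertical_lift hU hF hmem
  have hcomp : ∀ i, HasDerivAt (fun u : ℝ => (F ((x : ℂ) + (u : ℂ) * Complex.I) i).im * ℓ i)
      ((deriv F ((x : ℂ) + (u : ℂ) * Complex.I) i).re * ℓ i) u := by
    intro i
    have h1 : HasDerivAt (fun u : ℝ => F ((x : ℂ) + (u : ℂ) * Complex.I) i)
        (Complex.I * deriv F ((x : ℂ) + (u : ℂ) * Complex.I) i) u := by
      have h := (hasDerivAt_pi.1 hG) i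
      simpa [Pi.smul_apply, smul_eq_mul] using h
    have h2 := Complex.imCLM.hasFDerivAt.comp_hasDerivAt u h1
    have h3 : HasDerivAt (fun u : ℝ => (F ((x : ℂ) + (u : ℂ) * Complex.I) i).im)
        ((deriv F ((x : ℂ) + (u : ℂ) * Complex.I) i).re) u := by
      have e : Complex.imCLM (Complex.I * deriv F ((x : ℂ) + (u : ℂ) * Complex.I) i) =
          (deriv F ((x : ℂ) + (u : ℂ) * Complex.I) i).re := by
        rw [Complex.imCLM_apply, Complex.I_mul_im]
      rw [e] at h2
      exact h2
    exact h3.mul_const (ℓ i)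
  have hsum := HasDerivAt.fun_sum (u := Finset.univ) fun i _ => hcomp i
  have hlin : HasDerivAt (fun u : ℝ => u * ∑ i, T i * ℓ i) (∑ i, T i * ℓ i) u := by
    have h := (hasDerivAt_id u).mul_const (∑ i, T i * ℓ i)
    simpa using h
  have h := hsum.sub hlin
  have e : ∑ i ∈ Finset.univ, (deriv F ((x : ℂ) + (u : ℂ) * Complex.I) i).re * ℓ i - ∑ i, T i * ℓ i =
      ∑ i, ((deriv F ((x : ℂ) + (u : ℂ) * Complex.I) i).re - T i) * ℓ i := by
    rw [← Finset.sum_sub_distrib]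
    exact Finset.sum_congr rfl fun i _ => by ring
  rw [e] at h
  exact h

/-- **Projected horizontal smear of a vertical leg (second order).**  `F : ℂ → ℂ³` complex-differentiable on an open `U` with
`Σ (F′)ᵢ² = 1`, the vertical leg `x + i[0,t] ⊆ U` (`0 ≤ t`), a real vector `T` and a vector `T′` with `‖T − T′‖ ≤ ρ`, continuous profiles
`‖Im F′(x+iu)‖ ≤ q(u)`, `‖Re F′(x+iu) − T‖ ≤ e(u)` on `[0,t]`: then `|Σᵢ (Re Fᵢ(x+it) − Re Fᵢ(x))·T′ᵢ| ≤ ∫₀ᵗ q(u)(e(u) + ρ) du`. [folklore] -/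
theorem abs_re_proj_vertical_sub_le {U : Set ℂ} (hU : IsOpen U) {F : ℂ → (Fin 3 → ℂ)} (hF : DifferentiableOn ℂ F U)
    (hunit : ∀ w ∈ U, ∑ i, (deriv F w i) ^ 2 = 1) {x t : ℝ} (ht : 0 ≤ t)
    (hmem : ∀ u ∈ Icc (0:ℝ) t, (x : ℂ) + (u : ℂ) * Complex.I ∈ U) (T T' : Fin 3 → ℝ) {ρ : ℝ}
    (hρ : √(∑ i, (T i - T' i) ^ 2) ≤ ρ) {q e : ℝ → ℝ} (hqc : Continuous q) (hec : Continuous e)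
    (hq : ∀ u ∈ Icc (0:ℝ) t, √(∑ i, (deriv F ((x : ℂ) + (u : ℂ) * Complex.I) i).im ^ 2) ≤ q u)
    (he : ∀ u ∈ Icc (0:ℝ) t, √(∑ i, ((deriv F ((x : ℂ) + (u : ℂ) * Complex.I) i).re - T i) ^ 2) ≤ e u) :
    |∑ i, ((F ((x : ℂ) + (t : ℂ) * Complex.I) i).re - (F (x : ℂ) i).re) * T' i| ≤
      ∫ u in (0:ℝ)..t, q u * (e u + ρ) := by
  have hIcc : uIcc (0:ℝ) t = Icc 0 t := uIcc_of_le ht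
  set g : ℝ → ℝ := fun u => ∑ i, (F ((x : ℂ) + (u : ℂ) * Complex.I) i).re * T' i with hg
  set g' : ℝ → ℝ := fun u => -(∑ i, (deriv F ((x : ℂ) + (u : ℂ) * Complex.I) i).im * T' i) with hg'
  have hder : ∀ u ∈ uIcc (0:ℝ) t, HasDerivAt g (g' u) u := by
    intro u hu
    rw [hIcc] at hu
    exact hasDerivAt_re_proj_vertical hU hF (hmem u hu) T'
  -- continuity of `g'` on the leg
  have hdcont : ContinuousOn (deriv F) U := ((hF.analyticOnNhd hU).deriv).continuousOn
  have hpath : Continuous fun u : ℝ => (x : ℂ) + (u : ℂ) * Complex.I :=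
    continuous_const.add (Complex.continuous_ofReal.mul continuous_const)
  have hDc : ContinuousOn (fun u : ℝ => deriv F ((x : ℂ) + (u : ℂ) * Complex.I)) (uIcc (0:ℝ) t) := by
    rw [hIcc]; exact hdcont.comp hpath.continuousOn fun u hu => hmem u hu
  have hg'c : ContinuousOn g' (uIcc (0:ℝ) t) := by
    refine ContinuousOn.neg (continuousOn_finsetSum _ fun i _ => ?_)
    exact ((Complex.continuous_im.comp_continuousOn ((continuous_apply i).comp_continuousOn hDc)).mul
      continuousOn_const)
  have hftc := intervalIntegral.integral_eq_sub_of_hasDerivAt hder hg'c.intervalIntegrable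
  have hdiff : ∑ i, ((F ((x : ℂ) + (t : ℂ) * Complex.I) i).re - (F (x : ℂ) i).re) * T' i = g t - g 0 := by
    simp only [hg, Complex.ofReal_zero, zero_mul, add_zero, ← Finset.sum_sub_distrib]
    exact Finset.sum_congr rfl fun i _ => by ring
  rw [hdiff, ← hftc]
  have hb : ∀ᵐ u ∂volume, u ∈ Set.Ioc (0:ℝ) t → ‖g' u‖ ≤ q u * (e u + ρ) := by
    refine Filter.Eventually.of_forall fun u hu => ?_
    have hu' : u ∈ Icc (0:ℝ) t := Ioc_subset_Icc_self hu
    rw [hg', Real.norm_eq_abs, abs_neg]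
    exact abs_sum_im_mul_le_of_le' _ (hunit _ (hmem u hu')) T T' (hq u hu') (he u hu') hρ
  have hgi : IntervalIntegrable (fun u => q u * (e u + ρ)) volume (0:ℝ) t :=
    (hqc.mul (hec.add continuous_const)).intervalIntegrable _ _
  have h := intervalIntegral.norm_integral_le_of_norm_le ht hb hgi
  rwa [Real.norm_eq_abs] at h

/-- **Vertical displacement minus its linear part (Euclidean, second order).**  `F : ℂ → ℂ³` complex-differentiable on an open `U`, the
vertical leg `x + i[0,t] ⊆ U` (`0 ≤ t`), `F(x)` real, a real vector `T` and a continuous profile `‖Re F′(x+iu) − T‖ ≤ e(u)` on `[0,t]`: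
then `√Σᵢ (Im Fᵢ(x+it) − t·Tᵢ)² ≤ ∫₀ᵗ e(u) du`. [folklore] -/
theorem euclid_im_vertical_sub_linear_le {U : Set ℂ} (hU : IsOpen U) {F : ℂ → (Fin 3 → ℂ)} (hF : DifferentiableOn ℂ F U)
    {x t : ℝ} (ht : 0 ≤ t) (hmem : ∀ u ∈ Icc (0:ℝ) t, (x : ℂ) + (u : ℂ) * Complex.I ∈ U)
    (hreal : ∀ i, (F (x : ℂ) i).im = 0) (T : Fin 3 → ℝ) {e : ℝ → ℝ} (hec : Continuous e)
    (he : ∀ u ∈ Icc (0:ℝ) t, √(∑ i, ((deriv F ((x : ℂ) + (u : ℂ) * Complex.I) i).re - T i) ^ 2) ≤ e u) :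
    √(∑ i, ((F ((x : ℂ) + (t : ℂ) * Complex.I) i).im - t * T i) ^ 2) ≤ ∫ u in (0:ℝ)..t, e u := by
  have hIcc : uIcc (0:ℝ) t = Icc 0 t := uIcc_of_le ht
  have hdcont : ContinuousOn (deriv F) U := ((hF.analyticOnNhd hU).deriv).continuousOn
  have hpath : Continuous fun u : ℝ => (x : ℂ) + (u : ℂ) * Complex.I :=
    continuous_const.add (Complex.continuous_ofReal.mul continuous_const)
  have hDc : ContinuousOn (fun u : ℝ => deriv F ((x : ℂ) + (u : ℂ) * Complex.I)) (uIcc (0:ℝ) t) := by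
    rw [hIcc]; exact hdcont.comp hpath.continuousOn fun u hu => hmem u hu
  refine euclid_norm_le_of_forall_dot_le _ fun ℓ hℓ => ?_
  set g : ℝ → ℝ := fun u => ∑ i, (F ((x : ℂ) + (u : ℂ) * Complex.I) i).im * ℓ i - u * ∑ i, T i * ℓ i with hg
  set g' : ℝ → ℝ := fun u => ∑ i, ((deriv F ((x : ℂ) + (u : ℂ) * Complex.I) i).re - T i) * ℓ i with hg'
  have hder : ∀ u ∈ uIcc (0:ℝ) t, HasDerivAt g (g' u) u := by
    intro u hu
    rw [hIcc] at hu
    exact hasDerivAt_im_proj_vertical hU hF (hmem u hu) T ℓ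
  have hg'c : ContinuousOn g' (uIcc (0:ℝ) t) := by
    refine continuousOn_finsetSum _ fun i _ => ?_
    exact (((Complex.continuous_re.comp_continuousOn ((continuous_apply i).comp_continuousOn hDc)).sub
      continuousOn_const).mul continuousOn_const)
  have hftc := intervalIntegral.integral_eq_sub_of_hasDerivAt hder hg'c.intervalIntegrable
  have hg0 : g 0 = 0 := by
    simp [hg, hreal]
  have hdot : ∑ i, ((F ((x : ℂ) + (t : ℂ) * Complex.I) i).im - t * T i) * ℓ i = g t - g 0 := by
    rw [hg0, sub_zero]
    simp only [hg, Finset.mul_sum, ← Finset.sum_sub_distrib]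
    exact Finset.sum_congr rfl fun i _ => by ring
  rw [hdot, ← hftc]
  have hb : ∀ᵐ u ∂volume, u ∈ Set.Ioc (0:ℝ) t → ‖g' u‖ ≤ e u := by
    refine Filter.Eventually.of_forall fun u hu => ?_
    have hu' : u ∈ Icc (0:ℝ) t := Ioc_subset_Icc_self hu
    rw [hg', Real.norm_eq_abs]
    have h1 := abs_sum_mul_le_sqrt_mul_sqrt (fun i => (deriv F ((x : ℂ) + (u : ℂ) * Complex.I) i).re - T i) ℓ
    rw [hℓ, Real.sqrt_one, mul_one] at h1
    exact h1.trans (he u hu')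
  have h := intervalIntegral.norm_integral_le_of_norm_le ht hb (hec.intervalIntegrable _ _)
  rw [Real.norm_eq_abs] at h
  exact (le_abs_self _).trans h

/-- Real part of a complex square sum: `Re Σ vᵢ² = Σ (Re vᵢ)² − Σ (Im vᵢ)²`. [folklore] -/
theorem re_sum_sq_eq (v : Fin 3 → ℂ) :
    (∑ i, v i ^ 2).re = ∑ i, (v i).re ^ 2 - ∑ i, (v i).im ^ 2 := by
  rw [Complex.re_sum, ← Finset.sum_sub_distrib]
  exact Finset.sum_congr rfl fun i _ => by simp [sq, Complex.mul_re]

/-- **Lower bound for `Re Σ vᵢ²` from a projection of the real part and the Euclidean size of the imaginary part**: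
unit `T`, `a ≤ |Σ Re vᵢ·Tᵢ|`, `0 ≤ a`, `√Σ(Im vᵢ)² ≤ b` ⇒ `a² − b² ≤ Re Σ vᵢ²`. [folklore] -/
theorem re_sum_sq_ge_of_proj (v : Fin 3 → ℂ) (T : Fin 3 → ℝ) (hT : ∑ i, T i ^ 2 = 1) {a b : ℝ} (ha : 0 ≤ a)
    (hproj : a ≤ |∑ i, (v i).re * T i|) (him : √(∑ i, (v i).im ^ 2) ≤ b) :
    a ^ 2 - b ^ 2 ≤ (∑ i, v i ^ 2).re := by
  rw [re_sum_sq_eq]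
  have h1 : |∑ i, (v i).re * T i| ≤ √(∑ i, (v i).re ^ 2) := by
    have h := abs_sum_mul_le_sqrt_mul_sqrt (fun i => (v i).re) T
    rw [hT, Real.sqrt_one, mul_one] at h
    exact h
  have hre0 : 0 ≤ ∑ i, (v i).re ^ 2 := Finset.sum_nonneg fun i _ => sq_nonneg _
  have him0 : 0 ≤ ∑ i, (v i).im ^ 2 := Finset.sum_nonneg fun i _ => sq_nonneg _
  have h2 : a ^ 2 ≤ ∑ i, (v i).re ^ 2 := by
    have h3 : a ≤ √(∑ i, (v i).re ^ 2) := hproj.trans h1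
    have h4 := pow_le_pow_left₀ ha h3 2
    rwa [Real.sq_sqrt hre0] at h4
  have h5 : ∑ i, (v i).im ^ 2 ≤ b ^ 2 := by
    have hb : 0 ≤ b := (Real.sqrt_nonneg _).trans him
    have h6 := pow_le_pow_left₀ (Real.sqrt_nonneg _) him 2
    rwa [Real.sq_sqrt him0] at h6
  linarith

/-- **Vertical displacement of two feet.**  Unit real `T₁, T₂` with `√Σ(T₁ᵢ−T₂ᵢ)² ≤ ρ`, `0 ≤ Y`, `0 ≤ η`:
`√Σ (Y·T₁ᵢ − η·T₂ᵢ)² ≤ √((Y−η)² + Yη·ρ²)`. [folklore] -/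
theorem euclid_linear_feet_le (T₁ T₂ : Fin 3 → ℝ) (hT₁ : ∑ i, T₁ i ^ 2 = 1) (hT₂ : ∑ i, T₂ i ^ 2 = 1) {ρ Y η : ℝ}
    (hρ : √(∑ i, (T₁ i - T₂ i) ^ 2) ≤ ρ) (hY : 0 ≤ Y) (hη : 0 ≤ η) :
    √(∑ i, (Y * T₁ i - η * T₂ i) ^ 2) ≤ √((Y - η) ^ 2 + Y * η * ρ ^ 2) := by
  apply Real.sqrt_le_sqrt
  have hd0 : 0 ≤ ∑ i, (T₁ i - T₂ i) ^ 2 := Finset.sum_nonneg fun i _ => sq_nonneg _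
  have hd : ∑ i, (T₁ i - T₂ i) ^ 2 ≤ ρ ^ 2 := by
    have h := pow_le_pow_left₀ (Real.sqrt_nonneg _) hρ 2
    rwa [Real.sq_sqrt hd0] at h
  -- `Σ (Y T₁ − η T₂)² = (Y−η)² + Yη·Σ(T₁−T₂)²` using `Σ T₁² = Σ T₂² = 1`
  have hid : ∑ i, (Y * T₁ i - η * T₂ i) ^ 2 = (Y - η) ^ 2 + Y * η * ∑ i, (T₁ i - T₂ i) ^ 2 := by
    simp only [Fin.sum_univ_three] at hT₁ hT₂ ⊢
    linear_combination (Y ^ 2 - Y * η) * hT₁ + (η ^ 2 - Y * η) * hT₂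
  rw [hid]
  have hYη : 0 ≤ Y * η := mul_nonneg hY hη
  nlinarith

/-- **THE FOOT ESTIMATE.**  `F : ℂ → ℂ³` complex-differentiable on an open `U` with `Σ (F′)ᵢ² = 1`; target `x₁ + iY` and source
`x₂ + iη` (`0 ≤ Y, η`) whose vertical legs lie in `U`; `F` real at the feet with values `X₁, X₂ : ℝ³`; real unit tangents `T₁, T₂` at the
feet with `√Σ(T₁−T₂)² ≤ ρ`; chord projection `c₀ ≤ Σ (X₂ᵢ − X₁ᵢ)·T₁ᵢ`; continuous profiles on the legs:
`‖Im F′‖ ≤ q₁`, `‖Re F′ − T₁‖ ≤ e₁` on the target leg, `‖Im F′‖ ≤ q₂`, `‖Re F′ − T₂‖ ≤ e₂` on the source leg.  If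
`a := c₀ − ∫₀^Y q₁e₁ − ∫₀^η q₂(e₂+ρ) ≥ 0` then, with `b := √((Y−η)² + Yηρ²) + ∫₀^Y e₁ + ∫₀^η e₂`,
`a² − b² ≤ Re Σᵢ (Fᵢ(x₁+iY) − Fᵢ(x₂+iη))²`. [folklore] -/
theorem re_chord_sq_ge_of_feet {U : Set ℂ} (hU : IsOpen U) {F : ℂ → (Fin 3 → ℂ)} (hF : DifferentiableOn ℂ F U)
    (hunit : ∀ w ∈ U, ∑ i, (deriv F w i) ^ 2 = 1) {x₁ x₂ Y η : ℝ} (hY : 0 ≤ Y) (hη : 0 ≤ η)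
    (hmem₁ : ∀ u ∈ Icc (0:ℝ) Y, (x₁ : ℂ) + (u : ℂ) * Complex.I ∈ U)
    (hmem₂ : ∀ u ∈ Icc (0:ℝ) η, (x₂ : ℂ) + (u : ℂ) * Complex.I ∈ U)
    (X₁ X₂ : Fin 3 → ℝ) (hX₁ : ∀ i, F (x₁ : ℂ) i = (X₁ i : ℂ)) (hX₂ : ∀ i, F (x₂ : ℂ) i = (X₂ i : ℂ))
    (T₁ T₂ : Fin 3 → ℝ) (hT₁ : ∑ i, T₁ i ^ 2 = 1) (hT₂ : ∑ i, T₂ i ^ 2 = 1) {ρ : ℝ}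
    (hρ : √(∑ i, (T₁ i - T₂ i) ^ 2) ≤ ρ) {c₀ : ℝ} (hc₀ : c₀ ≤ ∑ i, (X₂ i - X₁ i) * T₁ i)
    {q₁ e₁ q₂ e₂ : ℝ → ℝ} (hq₁c : Continuous q₁) (he₁c : Continuous e₁) (hq₂c : Continuous q₂) (he₂c : Continuous e₂)
    (hq₁ : ∀ u ∈ Icc (0:ℝ) Y, √(∑ i, (deriv F ((x₁ : ℂ) + (u : ℂ) * Complex.I) i).im ^ 2) ≤ q₁ u)
    (he₁ : ∀ u ∈ Icc (0:ℝ) Y, √(∑ i, ((deriv F ((x₁ : ℂ) + (u : ℂ) * Complex.I) i).re - T₁ i) ^ 2) ≤ e₁ u)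
    (hq₂ : ∀ u ∈ Icc (0:ℝ) η, √(∑ i, (deriv F ((x₂ : ℂ) + (u : ℂ) * Complex.I) i).im ^ 2) ≤ q₂ u)
    (he₂ : ∀ u ∈ Icc (0:ℝ) η, √(∑ i, ((deriv F ((x₂ : ℂ) + (u : ℂ) * Complex.I) i).re - T₂ i) ^ 2) ≤ e₂ u)
    (ha : 0 ≤ c₀ - (∫ u in (0:ℝ)..Y, q₁ u * (e₁ u + 0)) - ∫ u in (0:ℝ)..η, q₂ u * (e₂ u + ρ)) :
    (c₀ - (∫ u in (0:ℝ)..Y, q₁ u * (e₁ u + 0)) - ∫ u in (0:ℝ)..η, q₂ u * (e₂ u + ρ)) ^ 2 -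
        (√((Y - η) ^ 2 + Y * η * ρ ^ 2) + (∫ u in (0:ℝ)..Y, e₁ u) + ∫ u in (0:ℝ)..η, e₂ u) ^ 2 ≤
      (∑ i, (F ((x₁ : ℂ) + (Y : ℂ) * Complex.I) i - F ((x₂ : ℂ) + (η : ℂ) * Complex.I) i) ^ 2).re := by
  set z₁ : ℂ := (x₁ : ℂ) + (Y : ℂ) * Complex.I with hz₁
  set z₂ : ℂ := (x₂ : ℂ) + (η : ℂ) * Complex.I with hz₂
  set v : Fin 3 → ℂ := fun i => F z₁ i - F z₂ i with hv
  -- the two horizontal smears, projected on `T₁`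
  have hρ₁₁ : √(∑ i, (T₁ i - T₁ i) ^ 2) ≤ 0 := by simp
  have hP₁ := abs_re_proj_vertical_sub_le hU hF hunit hY hmem₁ T₁ T₁ hρ₁₁ hq₁c he₁c hq₁ he₁
  have hρ₂₁ : √(∑ i, (T₂ i - T₁ i) ^ 2) ≤ ρ := by
    have : ∑ i, (T₂ i - T₁ i) ^ 2 = ∑ i, (T₁ i - T₂ i) ^ 2 := Finset.sum_congr rfl fun i _ => by ring
    rw [this]; exact hρ
  have hP₂ := abs_re_proj_vertical_sub_le hU hF hunit hη hmem₂ T₂ T₁ hρ₂₁ hq₂c he₂c hq₂ he₂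
  -- the two vertical displacements minus their linear parts
  have hreal₁ : ∀ i, (F (x₁ : ℂ) i).im = 0 := fun i => by rw [hX₁ i]; exact Complex.ofReal_im _
  have hreal₂ : ∀ i, (F (x₂ : ℂ) i).im = 0 := fun i => by rw [hX₂ i]; exact Complex.ofReal_im _
  have hV₁ := euclid_im_vertical_sub_linear_le hU hF hY hmem₁ hreal₁ T₁ he₁c he₁
  have hV₂ := euclid_im_vertical_sub_linear_le hU hF hη hmem₂ hreal₂ T₂ he₂c he₂
  -- abbreviations
  set J₁ : ℝ := ∫ u in (0:ℝ)..Y, q₁ u * (e₁ u + 0) with hJ₁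
  set J₂ : ℝ := ∫ u in (0:ℝ)..η, q₂ u * (e₂ u + ρ) with hJ₂
  set I₁ : ℝ := ∫ u in (0:ℝ)..Y, e₁ u with hI₁
  set I₂ : ℝ := ∫ u in (0:ℝ)..η, e₂ u with hI₂
  set a : ℝ := c₀ - J₁ - J₂ with hadef
  -- projection of the real part: `Σ Re vᵢ T₁ᵢ = (smear₁) − (smear₂) − Σ (X₂ − X₁) T₁`
  have hre_decomp : ∑ i, (v i).re * T₁ i =
      (∑ i, ((F z₁ i).re - (F (x₁ : ℂ) i).re) * T₁ i) - (∑ i, ((F z₂ i).re - (F (x₂ : ℂ) i).re) * T₁ i)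
        - ∑ i, (X₂ i - X₁ i) * T₁ i := by
    have h1 : ∀ i, (F (x₁ : ℂ) i).re = X₁ i := fun i => by rw [hX₁ i]; exact Complex.ofReal_re _
    have h2 : ∀ i, (F (x₂ : ℂ) i).re = X₂ i := fun i => by rw [hX₂ i]; exact Complex.ofReal_re _
    simp only [hv, Complex.sub_re, h1, h2, ← Finset.sum_sub_distrib]
    exact Finset.sum_congr rfl fun i _ => by ring
  have hproj : a ≤ |∑ i, (v i).re * T₁ i| := by
    rw [hre_decomp]
    have h1 := abs_le.1 hP₁
    have h2 := abs_le.1 hP₂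
    have h3 : a ≤ -( (∑ i, ((F z₁ i).re - (F (x₁ : ℂ) i).re) * T₁ i) -
        (∑ i, ((F z₂ i).re - (F (x₂ : ℂ) i).re) * T₁ i) - ∑ i, (X₂ i - X₁ i) * T₁ i) := by
      rw [hadef]; linarith
    exact h3.trans (neg_le_abs _)
  -- the imaginary part, by duality
  have him : √(∑ i, (v i).im ^ 2) ≤ √((Y - η) ^ 2 + Y * η * ρ ^ 2) + I₁ + I₂ := by
    refine euclid_norm_le_of_forall_dot_le _ fun ℓ hℓ => ?_
    -- `Im vᵢ = (Im F(z₁)ᵢ − Y T₁ᵢ) − (Im F(z₂)ᵢ − η T₂ᵢ) + (Y T₁ᵢ − η T₂ᵢ)`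
    have hsplit : ∑ i, (v i).im * ℓ i =
        (∑ i, ((F z₁ i).im - Y * T₁ i) * ℓ i) - (∑ i, ((F z₂ i).im - η * T₂ i) * ℓ i)
          + ∑ i, (Y * T₁ i - η * T₂ i) * ℓ i := by
      simp only [hv, Complex.sub_im, ← Finset.sum_sub_distrib, ← Finset.sum_add_distrib]
      exact Finset.sum_congr rfl fun i _ => by ring
    have hcs : ∀ w : Fin 3 → ℝ, ∑ i, w i * ℓ i ≤ √(∑ i, w i ^ 2) := fun w => by
      have h := sum_mul_le_sqrt_mul_sqrt w ℓ
      rwa [hℓ, Real.sqrt_one, mul_one] at h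
    have hcs' : ∀ w : Fin 3 → ℝ, -(∑ i, w i * ℓ i) ≤ √(∑ i, w i ^ 2) := fun w => by
      have h := abs_sum_mul_le_sqrt_mul_sqrt w ℓ
      rw [hℓ, Real.sqrt_one, mul_one] at h; exact (neg_le_abs _).trans h
    have h1 := (hcs fun i => (F z₁ i).im - Y * T₁ i).trans hV₁
    have h2 := (hcs' fun i => (F z₂ i).im - η * T₂ i).trans hV₂
    have h3 := (hcs fun i => Y * T₁ i - η * T₂ i).trans (euclid_linear_feet_le T₁ T₂ hT₁ hT₂ hρ hY hη)
    rw [hsplit]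
    linarith
  have hmain := re_sum_sq_ge_of_proj v T₁ hT₁ (by rw [hadef]; exact ha) hproj him
  simpa only [hv] using hmain

end Summit.NavierStokesRegularity.NavierStokesRegularity.Theorems.StadiumFootTangential

end
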